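import Summits.QuantumFields.YangMills.Theorems.UnitScaleTiltProp7TransplantGen1Engines
import Summits.QuantumFields.YangMills.Theorems.UnitScaleTiltProp7TransplantCutoffCommutatorV
import Summits.QuantumFields.YangMills.Theorems.UnitScaleTiltProp7TransplantFlatBiharmonic
import HarnessLib

/-!
# Route `UnitScaleTilt`, crux K1 «MinimiserStabilityRegPr» (stmt-QuantumFields-19200), route-R E′ (α′), (E1-b) CURVED, (A-cov) gen-1, FILE F2 «GEN-1 CUTOFF LAYER»: from ANY flat potential triple `(F₀, P₁, M₁)`,
# `Δ₁F₀ = P₁ − M₁` (J-half `P₁`, monopole `M₁`; routeR-w6 g7's FILE B v2 `exists_F0_rows` at the pole reference `c := b`), `Δ₁P₁ = J − Z`, rows in FILE B's shapes, the scale-`n` cutoff `χ′`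
# (✓ `exists_scale_cutoff b n`: `= 1` on `r ≤ n`, `= 0` for `r ≥ 5√3·n ≤ 9n − 1`; px11 (D5)) and px22's centre bumps (✓ `exists_bump_rows`; px11 (D4)) give the four gen-1 FIELDS of
# ✓p681947 `htr_body_of_rows'''`: `F := χ′•F₀ − Σ_y β_y•(χ′F₀)(e_y)` (VANISHES ON THE CENTRES ⇒ `u₁ := 0`), `F′ := χ′•P₁` (J-half ONLY: px11 (D2), the monopole rides TYPE-1),
# `c₁′ := Δ_flat F − F′`, `c₂′ := J − Δ_flat F′` (`m := 0`) — with `hFsplit`, `hF′` VERBATIM, supports in the engines' `hS` form (`F`, `c₁′` on `S′ = {tdist ≤ 9n + L^k}`; `F′`, `c₂′` on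
# `S = {tdist ≤ 9n}`), and the rows∕profiles `N2₁ H₁ S₁` read: uniform `Φ₀ Φ₁` for `F`; `Γ₁ + γ₁∕(1∨r)` for `c₁′`; `a₀√(R₀∕(1∨r))`, `a₁∕(1∨r) + (3∕(2n))a₀√(R₀∕(1∨r))` for `F′`;
# `a₃ + a₂∕(1∨r) + a₄√(2R₀∕(1∨r))` for `c₂′` — every constant a CLOSED FORM in FILE B's letters `C, D`, `n`, `L^k`, `d`, `c_d = 10√d + 6`; all DIFFERENCES of tree terms, no `def`.
Cell `ym3-torus`, width seat `ym3-torus-px11` (gen 4); routeR-w6 g7 00:43:32Z «px11: F2 GO», px11 g4 00:48Z reshapes (R-a)(R-b)(R-c); LOCATE-GEN1-DESIGN-px11g4; FILE A ✓p682215.  THEOREMS ONLY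
(0 `def`, 0 `sorry`); `--supports stmt-QuantumFields-19200`, count-neutral.  YM₃ on T³ is a ladder rung (R3), not the Clay problem; nothing here claims the stub, the crux, d = 4 or the gap.
WHAT IS PROVED (ns `…Theorems.Prop7TransplantGen1Cutoff`): §1 `cutoff_package`, `norm_one_sub_smul_density_le`, `stencil_vanish`, `sqrt_hs_le_of_norm_le`, `laplace_one_sub_vec`,
`sqrt_div_le_sqrt_two_mul_div`; §2 ★★★ `exists_cutoff_layer` — outputs (i1)(i2)(s1-F)(s1-F′)(s2)(s3)(r1)(r2′)(r1-Δ)(r3′)(r4′).  HONEST SCOPE: flat bookkeeping over ✓p680500 and ✓p682215;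
FILE B (potential rows) and FILE C (covariant numbers) are routeR-w6 g7's.
References: T. Bałaban, CMP 96 (1984) 223–250 [Balaban1984PropagatorsII] ((1.9) p.226); CMP 95 (1984) 17–40 [Balaban1984PropagatorsI] ((1.21) p.21); CMP 99 (1985) 75–102
[Balaban1985RegularSpaces] ((1.14) p.78, (1.36) p.82); CMP 99 (1985) 389–434 [Balaban1985BackgroundPropagators] ((3.8) p.392).
-/

set_option autoImplicit false

noncomputable section

open scoped BigOperators Matrix.Norms.L2Operator Matrix
open Finset

namespace Summit.QuantumFields.YangMills.Theorems.Prop7TransplantGen1Cutoff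

open Literature.MathematicalPhysics.QuantumFieldTheory.Balaban1983to89
open LatticeFieldCalculus (laplace)
open B9TorusCalculus (torusT torusT_apply torusT_symm_apply)
open B15DeterminingSets (embIter)
open B3Taylor310LocalRemainder (tdist_comm tdist_self)
open Prop7TorusAgmonWeight (exists_scale_cutoff)
open Prop7PinnedKernelGeometry (tdist_shift_le_add_one tdist_le_tdist_shift_add_one tdist_unshift_le_add_one tdist_le_tdist_unshift_add_one)
open Prop7HSOpNormSeam (sqrt_hs_le_sqrt_card_mul_norm)
open Prop7TransplantCutoffCommutatorV (norm_laplace_smul_sub_smul_laplace_le)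
open Prop7TransplantFlatBiharmonic (laplace_one_eq_flat)
open Prop7TransplantBumpRows (exists_bump_rows)
open Prop7TransplantGen1Engines (bumpInterp_rows_smul)
open Prop7TransplantDipolePotential (max_one_le_two_mul)

variable {P : Params} {N : ℕ}

/-- **THE SCALE-`n` CUTOFF AT THE POLE** (`3 ≤ n`, `d = 3`): `0 ≤ χ ≤ 1`, `χ = 1` on `{r ≤ n}`, `χ = 0` on `{r + 1 ≥ 9n}` (since `5√3·n ≤ 9n − 1`), steps `≤ 3∕(2n)`, second differences `≤ 9∕n²`.
[cite: Balaban1984PropagatorsII, (1.9) p.226] -/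
theorem cutoff_package (hd : P.d = 3) (b : Site P 0) (n : ℕ) (hn : 3 ≤ n) :
    ∃ χ : Site P 0 → ℝ, (∀ z, 0 ≤ χ z ∧ χ z ≤ 1) ∧ (∀ z, Site.tdist z b ≤ n → χ z = 1) ∧ (∀ z, 9 * n ≤ Site.tdist z b + 1 → χ z = 0) ∧
      (∀ z μ, |χ (z.shift μ) - χ z| ≤ 3 / (2 * (n : ℝ)) ∧ |χ (z.unshift μ) - χ z| ≤ 3 / (2 * (n : ℝ))) ∧
      (∀ z μ, |χ (z.shift μ) + χ (z.unshift μ) - 2 * χ z| ≤ 9 / (n : ℝ) ^ 2) := by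
  have hn1 : (1 : ℝ) ≤ n := by exact_mod_cast (le_trans (by norm_num) hn : 1 ≤ n)
  have hn3 : (3 : ℝ) ≤ n := by exact_mod_cast hn
  obtain ⟨χ, h01, hin, hout, h1, h2, -, -⟩ := exists_scale_cutoff (P := P) (j := 0) b hn1
  have hd3 : (P.d : ℝ) = 3 := by exact_mod_cast hd
  refine ⟨χ, h01, fun z hz => hin z (by exact_mod_cast hz), fun z hz => hout z ?_, h1, h2⟩
  have hz' : 9 * (n : ℝ) ≤ (Site.tdist z b : ℝ) + 1 := by exact_mod_cast hz
  have hs3 : Real.sqrt 3 ≤ 26 / 15 := by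
    have h := Real.sqrt_le_sqrt (show (3 : ℝ) ≤ (26 / 15) ^ 2 by norm_num)
    rwa [Real.sqrt_sq (by norm_num : (0 : ℝ) ≤ 26 / 15)] at h
  rw [hd3]
  nlinarith [hs3, Real.sqrt_nonneg 3]

/-- `‖(1 − χ z)•J z‖ ≤ D∕n²` for a density `‖J‖ ≤ D∕(1∨r)²` and a cutoff `χ ∈ [0,1]` equal to `1` on `{r ≤ n}`. [cite: Balaban1984PropagatorsII, (1.9) p.226] -/
theorem norm_one_sub_smul_density_le (b : Site P 0) (n : ℕ) (hn : 1 ≤ n) (χ : Site P 0 → ℝ) (h01 : ∀ z, 0 ≤ χ z ∧ χ z ≤ 1) (hin : ∀ z, Site.tdist z b ≤ n → χ z = 1)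
    (J : Site P 0 → Matrix (Fin N) (Fin N) ℂ) {D : ℝ} (hD : 0 ≤ D) (hJ : ∀ z, ‖J z‖ ≤ D / (max 1 ((Site.tdist z b : ℕ) : ℝ)) ^ 2) (z : Site P 0) :
    ‖(1 - χ z) • J z‖ ≤ D / (n : ℝ) ^ 2 := by
  have hn0 : (0 : ℝ) < n := by exact_mod_cast hn
  by_cases hz : Site.tdist z b ≤ n
  · rw [hin z hz, sub_self, zero_smul, norm_zero]; positivity
  · rw [not_le] at hz
    have hr : (n : ℝ) ≤ max 1 ((Site.tdist z b : ℕ) : ℝ) := le_trans (by exact_mod_cast hz.le) (le_max_right _ _)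
    have h1 : |1 - χ z| ≤ 1 := abs_le.2 ⟨by linarith [(h01 z).2], by linarith [(h01 z).1]⟩
    rw [norm_smul, Real.norm_eq_abs]
    calc _ ≤ 1 * (D / (max 1 ((Site.tdist z b : ℕ) : ℝ)) ^ 2) := mul_le_mul h1 (hJ z) (norm_nonneg _) zero_le_one
      _ ≤ D / (n : ℝ) ^ 2 := by
          rw [one_mul]
          exact div_le_div_of_nonneg_left hD (by positivity) (pow_le_pow_left₀ hn0.le hr 2)

/-- beyond `tdist ≥ 9n` the cutoff vanishes at `z` and at all its neighbours. [folklore] -/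
theorem stencil_vanish (b : Site P 0) (n : ℕ) (χ : Site P 0 → ℝ) (hout : ∀ z, 9 * n ≤ Site.tdist z b + 1 → χ z = 0) (z : Site P 0) (hz : 9 * n ≤ Site.tdist z b) :
    χ z = 0 ∧ (∀ μ, χ (z.shift μ) = 0) ∧ ∀ μ, χ (z.unshift μ) = 0 := by
  refine ⟨hout z (by omega), fun μ => hout _ ?_, fun μ => hout _ ?_⟩
  · have := tdist_le_tdist_shift_add_one z b μ; omega
  · have := tdist_le_tdist_unshift_add_one z b μ; omega

/-- `√hs(M) ≤ √N·B` from `‖M‖ ≤ B`. [folklore] -/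
theorem sqrt_hs_le_of_norm_le (M : Matrix (Fin N) (Fin N) ℂ) {B : ℝ} (h : ‖M‖ ≤ B) :
    Real.sqrt (∑ j : Fin N, ∑ k : Fin N, ‖M j k‖ ^ 2) ≤ Real.sqrt N * B :=
  (sqrt_hs_le_sqrt_card_mul_norm M).trans (mul_le_mul_of_nonneg_left h (Real.sqrt_nonneg _))

/-- `Δ₁(f − g) = Δ₁f − Δ₁g` pointwise, vector-valued. [cite: Balaban1984PropagatorsI, (1.21) p.21] -/
theorem laplace_one_sub_vec {V : Type*} [AddCommGroup V] [Module ℝ V] (f g : Site P 0 → V) (z : Site P 0) :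
    laplace 1 (fun w => f w - g w) z = laplace 1 f z - laplace 1 g z := by
  simp only [laplace, one_pow, one_smul, ← Finset.sum_sub_distrib]
  refine Finset.sum_congr rfl fun μ _ => ?_
  abel

/-- one site towards the pole costs `√2` in a `√(A∕(1∨r))` profile: `r ≤ s + 1 ⇒ √(A∕(1∨s)) ≤ √(2A∕(1∨r))` (`A ≥ 0`). [folklore] -/
theorem sqrt_div_le_sqrt_two_mul_div {r s : ℕ} (h : r ≤ s + 1) {A : ℝ} (hA : 0 ≤ A) :
    Real.sqrt (A / max 1 (s : ℝ)) ≤ Real.sqrt (2 * A / max 1 (r : ℝ)) := by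
  have hs : 0 < max 1 (s : ℝ) := lt_of_lt_of_le one_pos (le_max_left _ _)
  have hr : 0 < max 1 (r : ℝ) := lt_of_lt_of_le one_pos (le_max_left _ _)
  refine Real.sqrt_le_sqrt ?_
  rw [div_le_div_iff₀ hs hr]
  nlinarith [max_one_le_two_mul h, hA]

/-- ★★★ **THE gen-1 CUTOFF LAYER** (see the module docstring): the four fields `F F′ c₁′ c₂′` with `hFsplit`, `hF′` (`m := 0`) in ✓p681947's letters, `F = 0` on the centres, the supports in the engines'
`hS` form (`F`, `c₁′` on `S′ = {tdist ≤ 9n + L^k}`; `F′`, `c₂′` on `S = {tdist ≤ 9n}`), and all pointwise rows∕profiles, from a flat potential triple `Δ₁F₀ = P₁ − M₁`, `Δ₁P₁ = J − Z` with rows in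
FILE B v2's shapes at the pole reference and a density `‖J‖ ≤ D∕(1∨r)²` vanishing off `S`. [cite: Balaban1984PropagatorsII, (1.9) p.226; Balaban1984PropagatorsI, (1.21) p.21; Balaban1985RegularSpaces, (1.14) p.78;
Balaban1985BackgroundPropagators, (3.8) p.392] -/
theorem exists_cutoff_layer [DecidableEq (Site P 0)] (hd : P.d = 3) {k : ℕ} (hk : k ≤ P.m + P.K) (h3 : 3 ≤ P.L ^ k) (b : Site P 0) (n : ℕ) (hn : 3 ≤ n)
    (F₀ P₁ M₁ J Z : Site P 0 → Matrix (Fin N) (Fin N) ℂ)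
    (hΔF₀ : ∀ z, laplace 1 F₀ z = P₁ z - M₁ z) (hΔP₁ : ∀ z, laplace 1 P₁ z = J z - Z z)
    {C D ζ : ℝ} (hC : 0 ≤ C) (hD : 0 ≤ D)
    (hJ : ∀ y, ‖J y‖ ≤ D / (max 1 ((Site.tdist y b : ℕ) : ℝ)) ^ 2) (hJ0 : ∀ y, 9 * n < Site.tdist y b → J y = 0)
    (hF00 : ∀ z, ‖F₀ z‖ ≤ C * (D * (8 + 192 * ((9 * n : ℕ) : ℝ))) * (1 + 9 * n + (Site.tdist z b : ℝ)))
    (hF01 : ∀ z μ, ‖F₀ (z.shift μ) - F₀ z‖ ≤ C * (D * (8 + 192 * ((9 * n : ℕ) : ℝ))) ∧ ‖F₀ (z.unshift μ) - F₀ z‖ ≤ C * (D * (8 + 192 * ((9 * n : ℕ) : ℝ))))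
    (hP10 : ∀ z, Site.tdist z b ≤ 90 * n → ‖P₁ z‖ ≤ C * (D * Real.sqrt (3 * ((45 * n : ℕ) : ℝ) / max 1 ((Site.tdist z b : ℕ) : ℝ))))
    (hP11 : ∀ z μ, Site.tdist z b ≤ 88 * n →
      ‖P₁ (z.shift μ) - P₁ z‖ ≤ C * (D / max 1 ((Site.tdist z b : ℕ) : ℝ)) ∧ ‖P₁ (z.unshift μ) - P₁ z‖ ≤ C * (D / max 1 ((Site.tdist z b : ℕ) : ℝ)))
    (hM10 : ∀ z, ‖M₁ z‖ ≤ C * (D * (8 + 192 * ((9 * n : ℕ) : ℝ)) / max 1 ((Site.tdist z b : ℕ) : ℝ)))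
    (hZ : ∀ z, ‖Z z‖ ≤ ζ) :
    ∃ F F' c₁' c₂' : Site P 0 → Matrix (Fin N) (Fin N) ℂ,
      (∀ z, (∑ μ : Fin P.d, ((F z - F (torusT P 0 μ z)) + (F z - F ((torusT P 0 μ).symm z)))) = F' z + c₁' z) ∧
      (∀ z, (∑ ν : Fin P.d, ((F' z - F' (torusT P 0 ν z)) + (F' z - F' ((torusT P 0 ν).symm z)))) = J z - 0 - c₂' z) ∧
      (∀ z ∉ (univ.filter fun z : Site P 0 => Site.tdist z b ≤ 9 * n + P.L ^ k), F z = 0 ∧ (∀ μ, F (torusT P 0 μ z) = 0) ∧ ∀ μ, F ((torusT P 0 μ).symm z) = 0) ∧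
      (∀ z ∉ (univ.filter fun z : Site P 0 => Site.tdist z b ≤ 9 * n), F' z = 0 ∧ (∀ μ, F' (torusT P 0 μ z) = 0) ∧ ∀ μ, F' ((torusT P 0 μ).symm z) = 0) ∧
      (∀ z ∉ (univ.filter fun z : Site P 0 => Site.tdist z b ≤ 9 * n + P.L ^ k), c₁' z = 0) ∧
      (∀ z ∉ (univ.filter fun z : Site P 0 => Site.tdist z b ≤ 9 * n), c₂' z = 0) ∧
      (∀ y : Site P k, F (embIter k y) = 0) ∧
      (∀ z, ‖F z‖ ≤ 2 * (C * (D * (8 + 192 * ((9 * n : ℕ) : ℝ))) * (3 + 18 * n + (P.L : ℝ) ^ k))) ∧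
      (∀ z μ, ‖F (torusT P 0 μ z) - F z‖ ≤ C * (D * (8 + 192 * ((9 * n : ℕ) : ℝ))) + 3 / (2 * (n : ℝ)) * (C * (D * (8 + 192 * ((9 * n : ℕ) : ℝ))) * (3 + 18 * n + (P.L : ℝ) ^ k))
            + (C * (D * (8 + 192 * ((9 * n : ℕ) : ℝ))) * (3 + 18 * n + (P.L : ℝ) ^ k)) * (3 * (10 * Real.sqrt P.d + 6) / (2 * ((P.L : ℝ) ^ k))) ∧
        ‖F ((torusT P 0 μ).symm z) - F z‖ ≤ C * (D * (8 + 192 * ((9 * n : ℕ) : ℝ))) + 3 / (2 * (n : ℝ)) * (C * (D * (8 + 192 * ((9 * n : ℕ) : ℝ))) * (3 + 18 * n + (P.L : ℝ) ^ k))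
            + (C * (D * (8 + 192 * ((9 * n : ℕ) : ℝ))) * (3 + 18 * n + (P.L : ℝ) ^ k)) * (3 * (10 * Real.sqrt P.d + 6) / (2 * ((P.L : ℝ) ^ k)))) ∧
      (∀ z ∈ (univ.filter fun z : Site P 0 => Site.tdist z b ≤ 9 * n + P.L ^ k),
        ‖c₁' z‖ ≤ (P.d * (2 * (3 / (2 * (n : ℝ))) * (C * (D * (8 + 192 * ((9 * n : ℕ) : ℝ)))) + 9 / (n : ℝ) ^ 2 * (C * (D * (8 + 192 * ((9 * n : ℕ) : ℝ))) * (3 + 18 * n + (P.L : ℝ) ^ k)))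
              + (C * (D * (8 + 192 * ((9 * n : ℕ) : ℝ))) * (3 + 18 * n + (P.L : ℝ) ^ k)) * (9 * P.d * (10 * Real.sqrt P.d + 6) ^ 2 / ((P.L : ℝ) ^ k) ^ 2))
            + C * (D * (8 + 192 * ((9 * n : ℕ) : ℝ)) / max 1 ((Site.tdist z b : ℕ) : ℝ))) ∧
      (∀ z ∈ (univ.filter fun z : Site P 0 => Site.tdist z b ≤ 9 * n + P.L ^ k),
        Real.sqrt (∑ j : Fin N, ∑ k' : Fin N, ‖(∑ μ : Fin P.d, ((F z - F (torusT P 0 μ z)) + (F z - F ((torusT P 0 μ).symm z)))) j k'‖ ^ 2)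
          ≤ Real.sqrt N * (C * (D * Real.sqrt (3 * ((45 * n : ℕ) : ℝ) / max 1 ((Site.tdist z b : ℕ) : ℝ)))
            + ((P.d * (2 * (3 / (2 * (n : ℝ))) * (C * (D * (8 + 192 * ((9 * n : ℕ) : ℝ)))) + 9 / (n : ℝ) ^ 2 * (C * (D * (8 + 192 * ((9 * n : ℕ) : ℝ))) * (3 + 18 * n + (P.L : ℝ) ^ k)))
              + (C * (D * (8 + 192 * ((9 * n : ℕ) : ℝ))) * (3 + 18 * n + (P.L : ℝ) ^ k)) * (9 * P.d * (10 * Real.sqrt P.d + 6) ^ 2 / ((P.L : ℝ) ^ k) ^ 2))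
            + C * (D * (8 + 192 * ((9 * n : ℕ) : ℝ)) / max 1 ((Site.tdist z b : ℕ) : ℝ))))) ∧
      (∀ z ∈ (univ.filter fun z : Site P 0 => Site.tdist z b ≤ 9 * n), ‖F' z‖ ≤ C * (D * Real.sqrt (3 * ((45 * n : ℕ) : ℝ) / max 1 ((Site.tdist z b : ℕ) : ℝ)))) ∧
      (∀ z ∈ (univ.filter fun z : Site P 0 => Site.tdist z b ≤ 9 * n), ∀ μ,
        ‖F' (torusT P 0 μ z) - F' z‖ ≤ C * (D / max 1 ((Site.tdist z b : ℕ) : ℝ)) + 3 / (2 * (n : ℝ)) * (C * (D * Real.sqrt (3 * ((45 * n : ℕ) : ℝ) / max 1 ((Site.tdist z b : ℕ) : ℝ)))) ∧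
        ‖F' ((torusT P 0 μ).symm z) - F' z‖ ≤ C * (D / max 1 ((Site.tdist z b : ℕ) : ℝ)) + 3 / (2 * (n : ℝ)) * (C * (D * Real.sqrt (3 * ((45 * n : ℕ) : ℝ) / max 1 ((Site.tdist z b : ℕ) : ℝ))))) ∧
      (∀ z ∈ (univ.filter fun z : Site P 0 => Site.tdist z b ≤ 9 * n),
        ‖c₂' z‖ ≤ D / (n : ℝ) ^ 2 + ζ + P.d * (2 * (3 / (2 * (n : ℝ))) * (C * (D / max 1 ((Site.tdist z b : ℕ) : ℝ)))
          + 9 / (n : ℝ) ^ 2 * (C * (D * Real.sqrt (2 * (3 * ((45 * n : ℕ) : ℝ)) / max 1 ((Site.tdist z b : ℕ) : ℝ)))))) := by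
  classical
  obtain ⟨χ, h01, hin, hout, h1, h2⟩ := cutoff_package hd b n hn
  obtain ⟨β, B₁, B₂, rS, hB₁0, hB₁, hB₂0, hB₂, hsep, hβ1, hβ01, hβ0, hβd, hβL⟩ := exists_bump_rows (P := P) hk h3
  have hn1 : 1 ≤ n := le_trans (by norm_num) hn
  have hn0 : (0 : ℝ) < n := by exact_mod_cast (lt_of_lt_of_le (by norm_num) hn : 0 < n)
  set E : ℝ := D * (8 + 192 * ((9 * n : ℕ) : ℝ)) with hEdef
  have hE0 : 0 ≤ E := by rw [hEdef]; positivity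
  set Φp : ℝ := C * E * (3 + 18 * n + (P.L : ℝ) ^ k) with hΦpdef
  have hLk0 : (0 : ℝ) ≤ (P.L : ℝ) ^ k := by positivity
  have hΦp0 : 0 ≤ Φp := by rw [hΦpdef]; positivity
  set S : Finset (Site P 0) := univ.filter fun z : Site P 0 => Site.tdist z b ≤ 9 * n with hSdef
  set S' : Finset (Site P 0) := univ.filter fun z : Site P 0 => Site.tdist z b ≤ 9 * n + P.L ^ k with hS'def
  have hmemS : ∀ z, z ∈ S ↔ Site.tdist z b ≤ 9 * n := fun z => by rw [hSdef]; simp only [Finset.mem_filter, Finset.mem_univ, true_and]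
  have hmemS' : ∀ z, z ∈ S' ↔ Site.tdist z b ≤ 9 * n + P.L ^ k := fun z => by rw [hS'def]; simp only [Finset.mem_filter, Finset.mem_univ, true_and]
  have habsχ : ∀ z, |χ z| ≤ 1 := fun z => abs_le.2 ⟨by linarith [(h01 z).1], (h01 z).2⟩
  have hF0Φ : ∀ z, Site.tdist z b ≤ 9 * n + P.L ^ k + 2 → ‖F₀ z‖ ≤ Φp := by
    intro z hz
    refine (hF00 z).trans ?_
    rw [hΦpdef]
    have hz' : (Site.tdist z b : ℝ) ≤ 9 * n + (P.L : ℝ) ^ k + 2 := by exact_mod_cast hz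
    have hCE : 0 ≤ C * E := mul_nonneg hC hE0
    nlinarith
  set a : Site P k → Matrix (Fin N) (Fin N) ℂ := fun y => χ (embIter k y) • F₀ (embIter k y) with hadef
  have haD : ∀ y, ‖a y‖ ≤ Φp := by
    intro y
    simp only [hadef]
    by_cases hy : 9 * n ≤ Site.tdist (embIter k y) b + 1
    · rw [hout _ hy, zero_smul, norm_zero]; exact hΦp0
    · rw [norm_smul, Real.norm_eq_abs]
      calc _ ≤ 1 * Φp := mul_le_mul (habsχ _) (hF0Φ _ (by omega)) (norm_nonneg _) zero_le_one
        _ = Φp := one_mul _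
  have ha0 : ∀ y, 9 * n - 1 ≤ Site.tdist (embIter k y) b → a y = 0 := by
    intro y hy
    simp only [hadef]
    rw [hout _ (by omega), zero_smul]
  obtain ⟨hBval, hBnorm, hBstep, hBlap, hBfar⟩ := bumpInterp_rows_smul hk β hsep hβ1 hβ01 hβ0 hβd hβL a b (R := 9 * n - 1) hΦp0 haD ha0
  have hflat : ∀ (G : Site P 0 → Matrix (Fin N) (Fin N) ℂ) (z : Site P 0),
      (∑ μ : Fin P.d, ((G z - G (torusT P 0 μ z)) + (G z - G ((torusT P 0 μ).symm z)))) = laplace 1 G z := fun G z => (laplace_one_eq_flat G z).symm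
  have hBfar' : ∀ z, z ∉ S' → (∑ y, β y z • a y) = 0 ∧ (∀ μ, (∑ y, β y (z.shift μ) • a y) = 0) ∧ ∀ μ, (∑ y, β y (z.unshift μ) • a y) = 0 := by
    intro z hz
    rw [hmemS', not_le] at hz
    exact hBfar z (by omega)
  have hχfar' : ∀ z, z ∉ S' → χ z = 0 ∧ (∀ μ, χ (z.shift μ) = 0) ∧ ∀ μ, χ (z.unshift μ) = 0 := by
    intro z hz
    rw [hmemS', not_le] at hz
    exact stencil_vanish b n χ hout z (by omega)
  have hχfar : ∀ z, z ∉ S → χ z = 0 ∧ (∀ μ, χ (z.shift μ) = 0) ∧ ∀ μ, χ (z.unshift μ) = 0 := by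
    intro z hz
    rw [hmemS, not_le] at hz
    exact stencil_vanish b n χ hout z (by omega)
  have hcommF : ∀ z ∈ S', ‖laplace 1 (fun w => χ w • F₀ w) z - χ z • laplace 1 F₀ z‖ ≤ P.d * (2 * (3 / (2 * (n : ℝ))) * (C * E) + 9 / (n : ℝ) ^ 2 * Φp) := by
    intro z hz
    rw [hmemS'] at hz
    exact norm_laplace_smul_sub_smul_laplace_le χ F₀ z (fun ν => (h1 z ν).1) (fun ν => h2 z ν) (fun ν => hF01 z ν)
      (fun ν => hF0Φ _ (by have := tdist_unshift_le_add_one z b ν; omega))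
  have hP1u : ∀ z ∈ S, ∀ ν, ‖P₁ (z.unshift ν)‖ ≤ C * (D * Real.sqrt (2 * (3 * ((45 * n : ℕ) : ℝ)) / max 1 ((Site.tdist z b : ℕ) : ℝ))) := by
    intro z hz ν
    rw [hmemS] at hz
    have hz1 : Site.tdist (z.unshift ν) b ≤ 90 * n := by have := tdist_unshift_le_add_one z b ν; omega
    refine (hP10 _ hz1).trans (mul_le_mul_of_nonneg_left (mul_le_mul_of_nonneg_left ?_ hD) hC)
    exact sqrt_div_le_sqrt_two_mul_div (tdist_le_tdist_unshift_add_one z b ν) (by positivity)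
  have hcommP : ∀ z ∈ S, ‖laplace 1 (fun w => χ w • P₁ w) z - χ z • laplace 1 P₁ z‖
      ≤ P.d * (2 * (3 / (2 * (n : ℝ))) * (C * (D / max 1 ((Site.tdist z b : ℕ) : ℝ))) + 9 / (n : ℝ) ^ 2 * (C * (D * Real.sqrt (2 * (3 * ((45 * n : ℕ) : ℝ)) / max 1 ((Site.tdist z b : ℕ) : ℝ))))) := by
    intro z hz
    have hz' := (hmemS z).1 hz
    exact norm_laplace_smul_sub_smul_laplace_le χ P₁ z (fun ν => (h1 z ν).1) (fun ν => h2 z ν) (fun ν => hP11 z ν (by omega)) (fun ν => hP1u z hz ν)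
  refine ⟨fun z => χ z • F₀ z - ∑ y, β y z • a y, fun z => χ z • P₁ z,
    fun z => (∑ μ : Fin P.d, (((fun w => χ w • F₀ w - ∑ y, β y w • a y) z - (fun w => χ w • F₀ w - ∑ y, β y w • a y) (torusT P 0 μ z))
      + ((fun w => χ w • F₀ w - ∑ y, β y w • a y) z - (fun w => χ w • F₀ w - ∑ y, β y w • a y) ((torusT P 0 μ).symm z)))) - χ z • P₁ z,
    fun z => J z - (∑ ν : Fin P.d, (((fun w => χ w • P₁ w) z - (fun w => χ w • P₁ w) (torusT P 0 ν z)) + ((fun w => χ w • P₁ w) z - (fun w => χ w • P₁ w) ((torusT P 0 ν).symm z)))),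
    ?_, ?_, ?_, ?_, ?_, ?_, ?_, ?_, ?_, ?_, ?_, ?_, ?_, ?_⟩
  · -- (i1)
    intro z; beta_reduce; abel
  · -- (i2)
    intro z; beta_reduce; rw [sub_zero, sub_sub_cancel]
  · -- (s1-F)
    intro z hz
    have hz' : z ∉ S' := by rwa [hS'def] at hz
    obtain ⟨hz0, hs, hu⟩ := hχfar' z hz'
    obtain ⟨hb0, hbs, hbu⟩ := hBfar' z hz'
    refine ⟨?_, fun μ => ?_, fun μ => ?_⟩
    · show χ z • F₀ z - ∑ y, β y z • a y = 0
      rw [hz0, zero_smul, hb0, sub_zero]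
    · show χ (torusT P 0 μ z) • F₀ (torusT P 0 μ z) - ∑ y, β y (torusT P 0 μ z) • a y = 0
      rw [torusT_apply, hs μ, zero_smul, hbs μ, sub_zero]
    · show χ ((torusT P 0 μ).symm z) • F₀ ((torusT P 0 μ).symm z) - ∑ y, β y ((torusT P 0 μ).symm z) • a y = 0
      rw [torusT_symm_apply, hu μ, zero_smul, hbu μ, sub_zero]
  · -- (s1-F′)
    intro z hz
    have hz' : z ∉ S := by rwa [hSdef] at hz
    obtain ⟨hz0, hs, hu⟩ := hχfar z hz'
    refine ⟨by simp only [hz0, zero_smul], fun μ => by simp only [torusT_apply, hs μ, zero_smul], fun μ => by simp only [torusT_symm_apply, hu μ, zero_smul]⟩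
  · -- (s2) `c₁′` on `S′`
    intro z hz
    have hz' : z ∉ S' := by rwa [hS'def] at hz
    obtain ⟨hz0, hs, hu⟩ := hχfar' z hz'
    obtain ⟨hb0, hbs, hbu⟩ := hBfar' z hz'
    simp only [torusT_apply, torusT_symm_apply, hz0, hs, hu, hb0, hbs, hbu, zero_smul, sub_self, add_zero, Finset.sum_const_zero]
  · -- (s2) `c₂′` on `S`
    intro z hz
    have hz' : z ∉ S := by rwa [hSdef] at hz
    obtain ⟨hz0, hs, hu⟩ := hχfar z hz'
    have hJz : J z = 0 := hJ0 z (by rw [hmemS, not_le] at hz'; exact hz')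
    simp only [torusT_apply, torusT_symm_apply, hz0, hs, hu, zero_smul, sub_self, add_zero, Finset.sum_const_zero, hJz]
  · -- (s3) `F` vanishes on the centres
    intro y
    show χ (embIter k y) • F₀ (embIter k y) - ∑ y', β y' (embIter k y) • a y' = 0
    rw [hBval y, hadef]
    exact sub_self _
  · -- (r1) `‖F z‖ ≤ 2Φ⁺`
    intro z
    show ‖χ z • F₀ z - ∑ y, β y z • a y‖ ≤ 2 * Φp
    have hA : ‖χ z • F₀ z‖ ≤ Φp := by
      by_cases hz : 9 * n ≤ Site.tdist z b + 1
      · rw [hout z hz, zero_smul, norm_zero]; exact hΦp0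
      · rw [norm_smul, Real.norm_eq_abs]
        calc _ ≤ 1 * Φp := mul_le_mul (habsχ z) (hF0Φ z (by omega)) (norm_nonneg _) zero_le_one
          _ = Φp := one_mul _
    calc _ ≤ ‖χ z • F₀ z‖ + ‖∑ y, β y z • a y‖ := norm_sub_le _ _
      _ ≤ Φp + Φp := add_le_add hA (hBnorm z)
      _ = 2 * Φp := by ring
  · -- (r1) steps of `F`, all `z`
    intro z μ
    have hcut : ∀ (y : Site P 0), (Site.tdist z b ≤ Site.tdist y b + 1) → |χ y - χ z| ≤ 3 / (2 * (n : ℝ)) → ‖F₀ y - F₀ z‖ ≤ C * E →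
        ‖χ y • F₀ y - χ z • F₀ z‖ ≤ C * E + 3 / (2 * (n : ℝ)) * Φp := by
      intro y hyz hχy hFy
      by_cases hz : 9 * n ≤ Site.tdist z b
      · -- both cutoff values vanish
        rw [hout z (by omega), hout y (by omega), zero_smul, zero_smul, sub_zero, norm_zero]; positivity
      · have e : χ y • F₀ y - χ z • F₀ z = χ y • (F₀ y - F₀ z) + (χ y - χ z) • F₀ z := by rw [smul_sub, sub_smul]; abel
        rw [e]
        calc _ ≤ ‖χ y • (F₀ y - F₀ z)‖ + ‖(χ y - χ z) • F₀ z‖ := norm_add_le _ _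
          _ = |χ y| * ‖F₀ y - F₀ z‖ + |χ y - χ z| * ‖F₀ z‖ := by rw [norm_smul, norm_smul, Real.norm_eq_abs, Real.norm_eq_abs]
          _ ≤ 1 * (C * E) + 3 / (2 * (n : ℝ)) * Φp := add_le_add (mul_le_mul (habsχ y) hFy (norm_nonneg _) zero_le_one)
              (mul_le_mul hχy (hF0Φ z (by omega)) (norm_nonneg _) (by positivity))
          _ = _ := by rw [one_mul]
    have hB1' : Φp * B₁ ≤ Φp * (3 * (10 * Real.sqrt P.d + 6) / (2 * ((P.L : ℝ) ^ k))) := mul_le_mul_of_nonneg_left hB₁ hΦp0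
    have key : ∀ (y : Site P 0), ‖χ y • F₀ y - χ z • F₀ z‖ ≤ C * E + 3 / (2 * (n : ℝ)) * Φp → ‖(∑ w, β w y • a w) - ∑ w, β w z • a w‖ ≤ Φp * B₁ →
        ‖(χ y • F₀ y - ∑ w, β w y • a w) - (χ z • F₀ z - ∑ w, β w z • a w)‖ ≤ C * E + 3 / (2 * (n : ℝ)) * Φp + Φp * (3 * (10 * Real.sqrt P.d + 6) / (2 * ((P.L : ℝ) ^ k))) := by
      intro y h1y h2y
      have e : (χ y • F₀ y - ∑ w, β w y • a w) - (χ z • F₀ z - ∑ w, β w z • a w) = (χ y • F₀ y - χ z • F₀ z) - ((∑ w, β w y • a w) - ∑ w, β w z • a w) := by abel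
      rw [e]
      exact (norm_sub_le _ _).trans (add_le_add h1y (h2y.trans hB1'))
    simp only [torusT_apply, torusT_symm_apply]
    exact ⟨key _ (hcut _ (tdist_le_tdist_shift_add_one z b μ) (h1 z μ).1 (hF01 z μ).1) (hBstep z μ).1,
      key _ (hcut _ (tdist_le_tdist_unshift_add_one z b μ) (h1 z μ).2 (hF01 z μ).2) (hBstep z μ).2⟩
  · -- (r2′) `‖c₁′ z‖` on `S′`
    intro z hz
    have hzS' : z ∈ S' := by rwa [hS'def] at hz
    beta_reduce
    rw [hflat (fun w => χ w • F₀ w - ∑ y, β y w • a y) z, laplace_one_sub_vec]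
    have e : laplace 1 (fun w => χ w • F₀ w) z - laplace 1 (fun w => ∑ y, β y w • a y) z - χ z • P₁ z
        = (laplace 1 (fun w => χ w • F₀ w) z - χ z • laplace 1 F₀ z) - χ z • M₁ z - laplace 1 (fun w => ∑ y, β y w • a y) z := by
      rw [hΔF₀ z, smul_sub]; abel
    rw [e]
    have hB2' : Φp * B₂ ≤ Φp * (9 * P.d * (10 * Real.sqrt P.d + 6) ^ 2 / ((P.L : ℝ) ^ k) ^ 2) := mul_le_mul_of_nonneg_left hB₂ hΦp0
    calc _ ≤ ‖laplace 1 (fun w => χ w • F₀ w) z - χ z • laplace 1 F₀ z - χ z • M₁ z‖ + ‖laplace 1 (fun w => ∑ y, β y w • a y) z‖ := norm_sub_le _ _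
      _ ≤ (‖laplace 1 (fun w => χ w • F₀ w) z - χ z • laplace 1 F₀ z‖ + ‖χ z • M₁ z‖) + ‖laplace 1 (fun w => ∑ y, β y w • a y) z‖ := by
          gcongr; exact norm_sub_le _ _
      _ ≤ (P.d * (2 * (3 / (2 * (n : ℝ))) * (C * E) + 9 / (n : ℝ) ^ 2 * Φp) + C * (E / max 1 ((Site.tdist z b : ℕ) : ℝ))) + Φp * (9 * P.d * (10 * Real.sqrt P.d + 6) ^ 2 / ((P.L : ℝ) ^ k) ^ 2) := by
          gcongr
          · exact hcommF z hzS'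
          · rw [norm_smul, Real.norm_eq_abs]
            calc _ ≤ 1 * (C * (E / max 1 ((Site.tdist z b : ℕ) : ℝ))) := mul_le_mul (habsχ z) (hM10 z) (norm_nonneg _) zero_le_one
              _ = _ := one_mul _
          · exact (hBlap z).trans hB2'
      _ = _ := by ring
  · -- (r1-Δ) `√hs(Δ_flat F)` on `S′`
    intro z hz
    have hzS' : z ∈ S' := by rwa [hS'def] at hz
    have hz9 : Site.tdist z b ≤ 9 * n + P.L ^ k := (hmemS' z).1 hzS'
    refine sqrt_hs_le_of_norm_le _ ?_
    rw [hflat (fun w => χ w • F₀ w - ∑ y, β y w • a y) z, laplace_one_sub_vec]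
    have e : laplace 1 (fun w => χ w • F₀ w) z - laplace 1 (fun w => ∑ y, β y w • a y) z
        = χ z • P₁ z + ((laplace 1 (fun w => χ w • F₀ w) z - χ z • laplace 1 F₀ z) - χ z • M₁ z - laplace 1 (fun w => ∑ y, β y w • a y) z) := by
      rw [hΔF₀ z, smul_sub]; abel
    rw [e]
    have hB2' : Φp * B₂ ≤ Φp * (9 * P.d * (10 * Real.sqrt P.d + 6) ^ 2 / ((P.L : ℝ) ^ k) ^ 2) := mul_le_mul_of_nonneg_left hB₂ hΦp0
    have hP : ‖χ z • P₁ z‖ ≤ C * (D * Real.sqrt (3 * ((45 * n : ℕ) : ℝ) / max 1 ((Site.tdist z b : ℕ) : ℝ))) := by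
      by_cases hz : 9 * n ≤ Site.tdist z b + 1
      · rw [hout z hz, zero_smul, norm_zero]; positivity
      · rw [norm_smul, Real.norm_eq_abs]
        calc _ ≤ 1 * (C * (D * Real.sqrt (3 * ((45 * n : ℕ) : ℝ) / max 1 ((Site.tdist z b : ℕ) : ℝ)))) :=
              mul_le_mul (habsχ z) (hP10 z (by omega)) (norm_nonneg _) zero_le_one
          _ = _ := one_mul _
    calc _ ≤ ‖χ z • P₁ z‖ + ‖(laplace 1 (fun w => χ w • F₀ w) z - χ z • laplace 1 F₀ z) - χ z • M₁ z - laplace 1 (fun w => ∑ y, β y w • a y) z‖ := norm_add_le _ _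
      _ ≤ ‖χ z • P₁ z‖ + ((‖laplace 1 (fun w => χ w • F₀ w) z - χ z • laplace 1 F₀ z‖ + ‖χ z • M₁ z‖) + ‖laplace 1 (fun w => ∑ y, β y w • a y) z‖) := by
          gcongr
          exact (norm_sub_le _ _).trans (add_le_add (norm_sub_le _ _) le_rfl)
      _ ≤ C * (D * Real.sqrt (3 * ((45 * n : ℕ) : ℝ) / max 1 ((Site.tdist z b : ℕ) : ℝ)))
          + ((P.d * (2 * (3 / (2 * (n : ℝ))) * (C * E) + 9 / (n : ℝ) ^ 2 * Φp) + C * (E / max 1 ((Site.tdist z b : ℕ) : ℝ))) + Φp * (9 * P.d * (10 * Real.sqrt P.d + 6) ^ 2 / ((P.L : ℝ) ^ k) ^ 2)) := by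
          gcongr
          · exact hcommF z hzS'
          · rw [norm_smul, Real.norm_eq_abs]
            calc _ ≤ 1 * (C * (E / max 1 ((Site.tdist z b : ℕ) : ℝ))) := mul_le_mul (habsχ z) (hM10 z) (norm_nonneg _) zero_le_one
              _ = _ := one_mul _
          · exact (hBlap z).trans hB2'
      _ = _ := by ring
  · -- (r3′) `‖F′ z‖` on `S`
    intro z hz
    have hz9 : Site.tdist z b ≤ 9 * n := (hmemS z).1 (by rwa [hSdef] at hz)
    beta_reduce
    rw [norm_smul, Real.norm_eq_abs]
    calc _ ≤ 1 * (C * (D * Real.sqrt (3 * ((45 * n : ℕ) : ℝ) / max 1 ((Site.tdist z b : ℕ) : ℝ)))) := mul_le_mul (habsχ z) (hP10 z (by omega)) (norm_nonneg _) zero_le_one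
      _ = _ := one_mul _
  · -- (r3′) steps of `F′` on `S`
    intro z hz μ
    have hz9 : Site.tdist z b ≤ 9 * n := (hmemS z).1 (by rwa [hSdef] at hz)
    have key : ∀ (y : Site P 0), |χ y - χ z| ≤ 3 / (2 * (n : ℝ)) → ‖P₁ y - P₁ z‖ ≤ C * (D / max 1 ((Site.tdist z b : ℕ) : ℝ)) →
        ‖χ y • P₁ y - χ z • P₁ z‖ ≤ C * (D / max 1 ((Site.tdist z b : ℕ) : ℝ)) + 3 / (2 * (n : ℝ)) * (C * (D * Real.sqrt (3 * ((45 * n : ℕ) : ℝ) / max 1 ((Site.tdist z b : ℕ) : ℝ)))) := by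
      intro y hχy hPy
      have e : χ y • P₁ y - χ z • P₁ z = χ y • (P₁ y - P₁ z) + (χ y - χ z) • P₁ z := by rw [smul_sub, sub_smul]; abel
      rw [e]
      calc _ ≤ ‖χ y • (P₁ y - P₁ z)‖ + ‖(χ y - χ z) • P₁ z‖ := norm_add_le _ _
        _ = |χ y| * ‖P₁ y - P₁ z‖ + |χ y - χ z| * ‖P₁ z‖ := by rw [norm_smul, norm_smul, Real.norm_eq_abs, Real.norm_eq_abs]
        _ ≤ 1 * (C * (D / max 1 ((Site.tdist z b : ℕ) : ℝ))) + 3 / (2 * (n : ℝ)) * (C * (D * Real.sqrt (3 * ((45 * n : ℕ) : ℝ) / max 1 ((Site.tdist z b : ℕ) : ℝ)))) :=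
            add_le_add (mul_le_mul (habsχ y) hPy (norm_nonneg _) zero_le_one) (mul_le_mul hχy (hP10 z (by omega)) (norm_nonneg _) (by positivity))
        _ = _ := by rw [one_mul]
    simp only [torusT_apply, torusT_symm_apply]
    exact ⟨key _ (h1 z μ).1 (hP11 z μ (by omega)).1, key _ (h1 z μ).2 (hP11 z μ (by omega)).2⟩
  · -- (r4′) `‖c₂′ z‖` on `S`
    intro z hz
    have hzS : z ∈ S := by rwa [hSdef] at hz
    beta_reduce
    rw [hflat (fun w => χ w • P₁ w) z]
    have e : J z - laplace 1 (fun w => χ w • P₁ w) z = ((1 - χ z) • J z + χ z • Z z) - (laplace 1 (fun w => χ w • P₁ w) z - χ z • laplace 1 P₁ z) := by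
      rw [hΔP₁ z, smul_sub, sub_smul, one_smul]; abel
    rw [e]
    have hJ' := norm_one_sub_smul_density_le b n hn1 χ h01 hin J hD hJ z
    calc _ ≤ ‖(1 - χ z) • J z + χ z • Z z‖ + ‖laplace 1 (fun w => χ w • P₁ w) z - χ z • laplace 1 P₁ z‖ := norm_sub_le _ _
      _ ≤ (‖(1 - χ z) • J z‖ + ‖χ z • Z z‖) + ‖laplace 1 (fun w => χ w • P₁ w) z - χ z • laplace 1 P₁ z‖ := by gcongr; exact norm_add_le _ _
      _ ≤ (D / (n : ℝ) ^ 2 + ζ) + P.d * (2 * (3 / (2 * (n : ℝ))) * (C * (D / max 1 ((Site.tdist z b : ℕ) : ℝ))) + 9 / (n : ℝ) ^ 2 * (C * (D * Real.sqrt (2 * (3 * ((45 * n : ℕ) : ℝ)) / max 1 ((Site.tdist z b : ℕ) : ℝ))))) := by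
          gcongr
          · rw [norm_smul, Real.norm_eq_abs]
            calc _ ≤ 1 * ζ := mul_le_mul (habsχ z) (hZ z) (norm_nonneg _) zero_le_one
              _ = ζ := one_mul _
          · exact hcommP z hzS
      _ = _ := by ring

end Summit.QuantumFields.YangMills.Theorems.Prop7TransplantGen1Cutoff

end
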